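import Literature.NumberTheory.Automorphic.UnitaryCurveCotangentSpectralProjection
import Literature.NumberTheory.Automorphic.UnitaryCurveCotangentSpectralProjectionConj
import Literature.AlgebraicGeometry.ShimuraVarieties.UnitaryCurveConeSliceRegularity
import Summits.HodgeConjecture.HodgeConjecture.Theorems.F0P5TP2StubT
import Summits.HodgeConjecture.HodgeConjecture.Theorems.F0P5TP2StubH2ProjectedL2Data
import Summits.HodgeConjecture.HodgeConjecture.Theorems.F0P5TP2StubG
import Summits.HodgeConjecture.HodgeConjecture.Theorems.F0P5TP2StubS
import Summits.HodgeConjecture.HodgeConjecture.Theorems.F0P5TP2StubR2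
import Literature.NumberTheory.Automorphic.UnitaryCurveConeReproducingKernel
import HarnessLib

/-!
# Crux `HLiu418` — K-LANE SUB-LINE **F0-P5TP2SpectralProjection**: the P5 named fact TP₂
# `UnitaryCurveForms.holCotFormSpectralProjection₂` («the spectral projection `pr_P` of a cone-holomorphic cotangent form of the unitary
# Shimura CURVE is a cone-holomorphic cotangent form») CUT INTO SIX STUBS along the rank-2 HOLOMORPHIC-REPRODUCTION ROAD — the rank-2,
# chart-free twin of the 24833 (D)-line ★ `Cruxes/H413/Lines/F0_P2SpectralProjectionD.lean` (v1.5, all six stubs ★)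

SKELETON v4 (A-p14 (g16), 2026-08-31 [v4 = v3 + (N₂) := `fun h => h` over the letter ed. 3 (PHASE C)] — v0 ce659ab5 + the ★ closers (T₂) p802076, (H₂) p802104, (G₂) p802476, (K₂) p803171 F0P5-p01 (g2), (S₂) F0P2-p02 (g2) `Theorems/F0P5TP2StubS`, (R₂) A-p04 (g21) p803709 FOLDED BY NAME — only (N₂) open, closed by `fun h => h` after the R1 letter edition; statements byte-identical to v0; HOME-only draft for F0P5-plan (g0)'s review and A-plan1 (g18)'s `crux write`; card `.md` beside it;
F0P5-plan 00:54:43Z (2) + 01:41:56Z (1)).  Cell `hodgecm-mathlib`, floor 0, programme P5 (Alb-CM), crux item stmt-HodgeConjecture-24832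
(`HCCMUnconditional.HLiu418`); parent line `Lines/F0_AlbCm.lean` (ED. 4: mathematical stubs closed, named-fact stubs incl. `stub_TPhol :
UnitaryCurveForms.holCotFormSpectralProjection₂`).  HC_CM is proved only modulo the printed citations until rung 0 closes; nothing here is
asserted beyond the six `stub_*` (each `sorry`, each a closed named `Prop` stated over ★ declarations), and the parent's `stub_TPhol` folds by
the ONE token `F0P5TP2SpectralProjection.holCotFormSpectralProjection₂_of_stubs stub_N₂ stub_K₂ stub_S₂ stub_H₂ stub_R₂ stub_G₂ stub_T₂`.

## The road (rank-3 (D) census `F0/P2/CENSUS-R.F0P2p01g2.md` road (h), re-lettered; NO Sobolev, NO `(𝔤,K)`-theory, NO disc model)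

Write `u := [f] ∈ L²` for the class of `f ∈ holCotForms₂ 𝔣` (square-integrable on the compact quotient) and `w := pr_P u`.  Everything the
conclusion asks of a representative `Ψ` of `w` — left `U(H)(L⁺)`-invariance, right invariance under the compact archimedean factor `K_c` away
from `w₁ = cmPlace L ι` and under an open `K_f`, the right COTANGENT `K_∞`-TYPE `Ψ(x κ) = (a k⁻¹) Ψ(x)` for `κ ∈ U(σ_{w₁}H)` stabilising
`ℂ v₀` (frame coordinates `κ v₀ = k v₀`, `κ t₀ = a t₀ + d v₀`), and CAUCHY–RIEMANN ALONG THE `𝔭`-PROBE `z ↦ Ψ(x · exp (X z))` (★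
`UnitaryCurveCone.exists_coneProbe`) — has an `L²` SHADOW that (S₂) reads off `f` and (H₂) transports through `pr_P` (continuous, linear,
commuting with the right regular representation).  The one analytic input is the REPRODUCING KERNEL (K₂): a compactly supported smooth
function `A` on `U(σ_{w₁}H)` with `∫ A(u) Φ(u) dν(u) = Φ(1)` for every `IsConeHol 𝔣 Φ` (F0P5-p01 (g2)'s CHART-FREE construction: on the
cone-open `Φ(h) = λ(h) F(ζ(h))` with `F` holomorphic on a disc by the cone law and clause 1 of `IsConeHol` along the affine section
`ζ ↦ 1 + ζ N`, then the one-variable mean value property and `K_∞`-invariance of Haar); in `L²`, `T_A u = u`, hence `T_A w = w`.  (R₂) gives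
reproduced classes continuous representatives, `C¹` along the probes with probe derivatives representing the `L²` derivatives; (G₂) upgrades
weak Cauchy–Riemann to pointwise; (T₂) turns a.e. invariances ∕ type into pointwise ones and — by the ★ rank-2 CONE DICTIONARY
`UnitaryCurveCone.mem_holCotForms₂_of_probeCR` (A-p14, p800952) — concludes `Ψ ∈ holCotForms₂ 𝔣`; `[Ψ] = w` closes TP₂.  (N₂) is the
NORMALISATION of the letter's scalar `t` (R1 of the card): the letter quantifies over `t ≠ 0` with `formCongr c g (t • H) = diagonal dV`, so
`σ_{w₁}H` is hermitian only up to `ι(t)⁻¹`; every consumer (★ `HLiu418S1BettiSliceLines` :86, `…SliceExclusion`, `F0AlbCmS1bSignedExclusion`)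
holds `0 < (ι t).re ∧ (ι t).im = 0`, under which `σ_{w₁}H` IS hermitian; the five analytic stubs are stated under the honest binder «`σ_{w₁}H` hermitian» and (N₂)
carries the reduction of the letter to them (the desk may instead add the consumers' two binders to the letter — then `stub_N₂` is the 20-line
hermitian-ness lemma; see the card).

## Registered stubs (7 = 6 + the normalisation; sizes in the docstrings)
* `stub_N₂ : StubN₂Normalisation` — (N₂) S (or 0 after a letter edit): TP₂ from TP₂-at-hermitian-`σ_{w₁}H`.
* `stub_K₂ : StubK₂ReproducingKernel` — (K₂) M: the chart-free reproducing kernel on `U(σ_{w₁}H)` (F0P5-p01 (g2) 01:36:27Z (i)).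
* `stub_S₂ : StubS₂CotFormL2Data` — (S₂) M: `[f]` carries `IsL2CotPair₁`.
* `stub_H₂ : StubH₂ProjectedL2Data` — (H₂) S–M: `IsL2CotPair₁ u → IsL2CotPair₁ (pr_P u)` (re-instantiation of ★ A-p06 p797557).
* `stub_R₂ : StubR₂RegularOfReproduced` — (R₂) M: reproduced `K_c K_f`-invariant classes have `Realises₁`-representatives (port of ★ p798202∕p798945).
* `stub_G₂ : StubG₂ProbeCROfWeak` — (G₂) M−: `Realises₁` + `IsWeaklyHol₁` ⇒ pointwise probe differentiability + CR (port of ★ p797242).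
* `stub_T₂ : StubT₂MemHolCotFormsOfAe` — (T₂) M−: `Realises₁` + `L²` relations + pointwise CR ⇒ `Ψ ∈ holCotForms₂` (a.e. ⇒ pointwise as ★
  `F0P2dStubT` §1, then ★ `UnitaryCurveCone.mem_holCotForms₂_of_probeCR`).
Heads: `holCotFormSpectralProjection₂Herm_of` (sorry-free composition at hermitian `σ_{w₁}H`), `holCotFormSpectralProjection₂_of_stubs` (the named
fact BY NAME), `antiholCotFormSpectralProjection₂_of_stubs` (★ `…_of_hol`), `socketTP₂_of_stubs` (both).  HC_CM is proved only modulo the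
printed citations until rung 0 closes.

## References
* [BorelJacquet1979] A. Borel, H. Jacquet, Corvallis PSPM 33.1 (1979), §4.1–4.2, §4.6 (`pr_P` is `G(𝔸)`-equivariant).
* [Borel1997] A. Borel, *Automorphic forms on SL₂(ℝ)* (1997), Thm. 2.13–2.14 and §8.4 (regularity by convolution), §5.13–§5.14.
* [HarishChandra1966] Harish-Chandra, *Discrete series II*, Acta Math. 116 (1966), §8 Thm. 1 (`φ = φ ∗ α`).
* [BergeronMillsonMoeglin2016Balls] N. Bergeron, J. Millson, C. Moeglin, Acta Math. 216 (2016), Part 2 §1.3.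
-/

set_option autoImplicit false
set_option linter.dupNamespace false

noncomputable section

open scoped Matrix ComplexOrder ContDiff
open NumberField NumberField.InfinitePlace MeasureTheory
open Literature.NumberTheory.Automorphic Literature.NumberTheory.Automorphic.UnitaryGroup
open Literature.NumberTheory.Automorphic.UnitaryCurveForms
open Literature.NumberTheory.Automorphic.UnitaryGroup.CotangentForms (toQuotFun)
open Literature.AlgebraicGeometry.ShimuraVarieties

namespace Summit.HodgeConjecture.HodgeConjecture.Cruxes.HLiu418.F0P5TP2SpectralProjection

/-! ## §0 Lines-local bundles (closers UNFOLD these verbatim; nothing here is a new mathematical object).  The rank-3 (D) bundles of ★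
`Cruxes/H413/Lines/F0_P2SpectralProjectionD.lean` re-lettered: `U21 ↦` a group `S` with a section `ιinf : S →* G(𝔸)` (here `S = U(σ_{w₁}H)(ℂ)`,
`ιinf = adelicSingle w₁`), `expP ↦` a probe family `γ : ℂ → S` (here `γ z = exp (X z)` for the frame's `𝔭`-probe `X`), two coordinates ↦ one. -/

section Generic

variable {K : Type} [Field K] [NumberField K] (𝒢 : AdelicGroupData.{0} K)
  (μ : Measure 𝒢.automorphicQuotient) [SMulInvariantMeasure 𝒢.Adelic 𝒢.automorphicQuotient μ]
  {S : Type} [Group S] (ιinf : S →* 𝒢.Adelic) (γ : ℂ → S)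

/-- **The `𝔭`-orbit map of an `L²` class** along the probe family `γ` read through the section `ιinf`: `z ↦ R(ιinf (γ z)) v`
(★ `AdelicGroupData.rightRegular`). (print: BorelWallach2000, XIII 1.2) -/
def orbitP₁ (v : 𝒢.L2 μ) : ℂ → 𝒢.L2 μ :=
  fun z => 𝒢.rightRegular μ (ιinf (γ z)) v

/-- **The `𝔭`-probe of a scalar function at a base point `y`**: `z ↦ Ψ (y · ιinf (γ z))`. (print: Borel1997, §5.14) -/
def probeP₁ (Ψ : 𝒢.Adelic → ℂ) (y : 𝒢.Adelic) : ℂ → ℂ :=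
  fun z => Ψ (y * ιinf (γ z))

/-- **The kernel operator of a SCALAR kernel on `S` acting on `L²` classes**: `T_A v := ∫_S A(u) • R(ιinf u) v dν(u)` (Bochner integral in `L²`;
the `L²` form of right convolution by `A`). (print: Borel1997, §2.13–2.14) (print: HarishChandra1966, §8) -/
def kernelOp₁ [MeasurableSpace S] (ν : Measure S) (A : S → ℂ) (v : 𝒢.L2 μ) : 𝒢.L2 μ :=
  ∫ u, A u • 𝒢.rightRegular μ (ιinf u) v ∂ν

/-- **Weak (`L²`) Cauchy–Riemann**: the differential at `0` of the `𝔭`-orbit map of `v` is `ℂ`-linear. (print: Borel1997, §5.14) -/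
def IsWeaklyHol₁ (v : 𝒢.L2 μ) : Prop :=
  ∀ z : ℂ, fderiv ℝ (orbitP₁ 𝒢 μ ιinf γ v) 0 (Complex.I • z) = Complex.I • fderiv ℝ (orbitP₁ 𝒢 μ ιinf γ v) 0 z

/-- **`Realises₁ … Ψ w` — `Ψ` is a REGULAR REPRESENTATIVE of the `L²` class `w`**: left-invariant under `A_G · G(K)`, continuous, of class `w`,
differentiable at `0` along the `𝔭`-probe at every base point with probe derivatives continuous in the base point and REPRESENTING the
`L²`-derivatives of the `𝔭`-orbit map of `w`. (print: Borel1997, Thm. 2.13 and §8.4) -/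
structure Realises₁ (Ψ : 𝒢.Adelic → ℂ) (w : 𝒢.L2 μ) : Prop where
  leftInv : ∀ γr ∈ 𝒢.quotientSubgroup, ∀ x, Ψ (γr * x) = Ψ x
  cont : Continuous Ψ
  aeEq : toQuotFun 𝒢 Ψ =ᵐ[μ] (w : 𝒢.automorphicQuotient → ℂ)
  diff : ∀ y, DifferentiableAt ℝ (probeP₁ 𝒢 ιinf γ Ψ y) 0
  contDeriv : ∀ z : ℂ, Continuous fun y => fderiv ℝ (probeP₁ 𝒢 ιinf γ Ψ y) 0 z
  derivAe : ∀ z : ℂ,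
    toQuotFun 𝒢 (fun y => fderiv ℝ (probeP₁ 𝒢 ιinf γ Ψ y) 0 z) =ᵐ[μ]
      ((fderiv ℝ (orbitP₁ 𝒢 μ ιinf γ w) 0 z : 𝒢.L2 μ) : 𝒢.automorphicQuotient → ℂ)

/-- **`IsRegularKernel₁ γ A` — a continuous, compactly supported SCALAR kernel on the topological group `S` that is `C¹` along the LEFT probes**
`z ↦ A(γ z · u′)` with jointly continuous probe derivative (what differentiating `∫ A((γ z)⁻¹ u′) w̃(y · ιinf u′) dν(u′)` under the integral sign
needs). (print: Borel1997, §2.13) (print: HarishChandra1966, §8) -/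
structure IsRegularKernel₁ [TopologicalSpace S] (A : S → ℂ) : Prop where
  cont : Continuous A
  supp : HasCompactSupport A
  diff : ∀ u' : S, ContDiff ℝ 1 fun z : ℂ => A (γ z * u')
  contDeriv : Continuous fun p : ℂ × S => fderiv ℝ (fun z : ℂ => A (γ z * p.2)) p.1

end Generic

section Engine

variable (L : Type) [Field L] [NumberField L] [IsCMField L]

/-- The engine datum `U(H)` over `L⁺` at rank 2 (★ `UnitaryGroup.adelicGroupData` at `(L⁺, L, c̄, 2, H)`), abbreviated. (print: BorelJacquet1979, §4.1) -/
abbrev G2 (H : Matrix (Fin 2) (Fin 2) L) : AdelicGroupData.{0} (↥(maximalRealSubfield L)) :=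
  adelicGroupData (↥(maximalRealSubfield L)) L (IsCMField.complexConj L) 2 H

variable (ι : L →+* ℂ) (H : Matrix (Fin 2) (Fin 2) L)

/-- The archimedean section at `w₁ = cmPlace L ι`: `adelicSingle w₁ : U(σ_{w₁}H)(ℂ) →* U(H)(𝔸_{L⁺})` (★ `UnitaryGroupArchSection`), abbreviated.
(print: BorelJacquet1979, §4.1) -/
abbrev sec₁ : archLocal L 2 H (cmPlace L ι) →* (G2 L H).Adelic :=
  adelicSingle (↥(maximalRealSubfield L)) L (IsCMField.complexConj L) 2 H (IsCMField.complexConj_ne_one L)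
    (UnitaryGroup.complexConj_smul_infinitePlace L) (cmPlace L ι)

/-- The compact archimedean factor AWAY from `w₁` (the `K_c` of ★ `holCotForms₂`), abbreviated. (print: BorelJacquet1979, §4.2) -/
abbrev Kc₁ : Subgroup (G2 L H).Adelic :=
  ((archAt (↥(maximalRealSubfield L)) L (IsCMField.complexConj L) 2 H (cmPlace L ι)
      (UnitaryGroup.complexConj_smul_infinitePlace L (cmPlace L ι).1) (IsCMField.complexConj_ne_one L)).ker).map
    (archToAdelic (↥(maximalRealSubfield L)) L (IsCMField.complexConj L) 2 H)

variable (𝔣 : ConeFrame L H (cmPlace L ι)) (γ : ℂ → archLocal L 2 H (cmPlace L ι))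
  (μ : Measure (G2 L H).automorphicQuotient) [(G2 L H).IsAutomorphicMeasure μ]

/-- **`IsL2CotPair₁ … ν A u` — the `L²`-LEVEL COTANGENT DATA of a class `u`** (what `pr_P` can see of a cone-holomorphic cotangent form):
REPRODUCTION `T_A u = u`, right `K_c`-invariance, right invariance under an OPEN `K_f ≤ U(H)(𝔸_{L⁺,f})`, the cotangent `K_∞`-TYPE RELATION
`R(sec κ) u = (a k⁻¹) • u` for `κ ∈ U(σ_{w₁}H)` with frame coordinates `(k, a, d)`, differentiability at `0` of the `𝔭`-orbit map along `γ`, and weak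
Cauchy–Riemann. (print: BorelJacquet1979, §4.2 and §4.6) (print: Borel1997, §2.13 and §5.14) -/
structure IsL2CotPair₁ [MeasurableSpace (archLocal L 2 H (cmPlace L ι))] (ν : Measure (archLocal L 2 H (cmPlace L ι)))
    (A : archLocal L 2 H (cmPlace L ι) → ℂ) (u : (G2 L H).L2 μ) : Prop where
  repro : kernelOp₁ (G2 L H) μ (sec₁ L ι H) ν A u = u
  kc : ∀ k ∈ Kc₁ L ι H, (G2 L H).rightRegular μ k u = u
  kf : ∃ Kf : Subgroup (finAdelic (↥(maximalRealSubfield L)) L (IsCMField.complexConj L) 2 H),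
    IsOpen (Kf : Set (finAdelic (↥(maximalRealSubfield L)) L (IsCMField.complexConj L) 2 H)) ∧
      ∀ k ∈ Kf, (G2 L H).rightRegular μ (finAdelicToAdelic (↥(maximalRealSubfield L)) L (IsCMField.complexConj L) 2 H k) u = u
  ktype : ∀ (κ : archLocal L 2 H (cmPlace L ι)) (a k d : ℂ), k ≠ 0 →
    ((κ : GL (Fin 2) ℂ) : Matrix (Fin 2) (Fin 2) ℂ) *ᵥ 𝔣.v₀ = k • 𝔣.v₀ →
    ((κ : GL (Fin 2) ℂ) : Matrix (Fin 2) (Fin 2) ℂ) *ᵥ 𝔣.t₀ = a • 𝔣.t₀ + d • 𝔣.v₀ →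
      (G2 L H).rightRegular μ (sec₁ L ι H κ) u = (a * k⁻¹) • u
  diffOrbit : DifferentiableAt ℝ (orbitP₁ (G2 L H) μ (sec₁ L ι H) γ u) 0
  weakHol : IsWeaklyHol₁ (G2 L H) μ (sec₁ L ι H) γ u

end Engine

/-! ## §1 The letter at hermitian `σ_{w₁}H` (the five analytic stubs live here; (N₂) carries the general letter) -/

/-- **TP₂ AT HERMITIAN `σ_{w₁}H`** — the body of ★ `UnitaryCurveForms.holCotFormSpectralProjection₂` with ONE extra binder
`(H.map (cmPlace L ι).1.embedding).IsHermitian` inserted after the diagonalisation hypothesis.  Every consumer holds `0 < (ι t).re ∧ (ι t).im = 0` (★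
`HLiu418S1BettiSliceLines` :86 `_hτt _hτt'`), under which `σ_{w₁}(t • H) = ι(t) • σ_{w₁}H` is congruent to the real diagonal `ι(dV)` and `ι(t)` is a
non-zero real, so the extra binder holds there; (N₂) carries the reduction of the letter to this statement. (print: BorelJacquet1979, §4.6) -/
def HolCotFormSpectralProjection₂Herm : Prop :=
  ∀ (L : Type) [Field L] [NumberField L] [IsCMField L] (ι : L →+* ℂ) (H : Matrix (Fin 2) (Fin 2) L)
    (dV : Fin 2 → L) (_hdV : ∀ i, IsCMField.complexConj L (dV i) = dV i) (_hdV0 : ∀ i, dV i ≠ 0)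
    (t : L) (_ht : t ≠ 0) (g : GL (Fin 2) L),
    formCongr ((IsCMField.complexConj L : L ≃ₐ[↥(maximalRealSubfield L)] L) : L →+* L) g (t • H) = Matrix.diagonal dV →
    (H.map (cmPlace L ι).1.embedding).IsHermitian →
    (∃ T : GL (Fin 2) ℂ, formCongr (starRingEnd ℂ) T ((Matrix.diagonal dV).map ι) = Matrix.diagonal ![(1 : ℂ), -1]) →
    (∀ τ' : L →+* ℂ, InfinitePlace.mk τ' ≠ InfinitePlace.mk ι → ((Matrix.diagonal dV).map τ').PosDef) →
    4 ≤ Module.finrank ℚ L →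
    ∀ (𝔣 : ConeFrame L H (cmPlace L ι))
      (μ : Measure (G2 L H).automorphicQuotient) [(G2 L H).IsAutomorphicMeasure μ]
      (P : DiscreteAutomorphicRep (G2 L H) μ) (f : (G2 L H).Adelic → ℂ),
      f ∈ holCotForms₂ (↥(maximalRealSubfield L)) L (IsCMField.complexConj L) H (IsCMField.complexConj_ne_one L)
          (UnitaryGroup.complexConj_smul_infinitePlace L) (cmPlace L ι) 𝔣 →
    ∀ hf : MemLp (toQuotFun (G2 L H) f) 2 μ,
      ∃ f' ∈ holCotForms₂ (↥(maximalRealSubfield L)) L (IsCMField.complexConj L) H (IsCMField.complexConj_ne_one L)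
          (UnitaryGroup.complexConj_smul_infinitePlace L) (cmPlace L ι) 𝔣,
        ∃ hf' : MemLp (toQuotFun (G2 L H) f') 2 μ,
          P.space.toSubmodule.starProjection (MemLp.toLp (toQuotFun (G2 L H) f) hf) = MemLp.toLp (toQuotFun (G2 L H) f') hf'

/-! ## §2 The seven registered stubs -/

/-- **(N₂) NORMALISATION OF THE SCALAR `t`.**  The letter quantifies over `t ≠ 0`; if `(ι t).im ≠ 0` or `(ι t).re ≤ 0` the hermitian part of
`σ_{w₁}H = ι(t)⁻¹ σ_{w₁}(tH)` is `Re(ι(t)⁻¹) · σ_{w₁}(tH)`: when `Re ι(t)⁻¹ = 0` NO cone frame exists (`negCone (σ_{w₁}H) = ∅` since `⟪v, σ(tH) v⟫` is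
real), so the letter is vacuous; when `Re ι(t)⁻¹ < 0` the roles of the negative and positive cones swap.  CLOSER: either (α) the desk adds the two
binders `0 < (ι t).re`, `(ι t).im = 0` to the letter (consumers already hold them; then this stub is the short lemma «`formCongr c g (t • H) = diagonal dV`,
`dV` real, `ι t ∈ ℝˣ` ⇒ `σ_{w₁}H` hermitian»), or (β) a
transport of `holCotForms₂`∕`adelicGroupData` along `H ↦ s • H` for a scalar `s` with `U(sH) = U(H)` plus the vacuous case.  Size S under (α), M–L
under (β). (print: BorelJacquet1979, §4.6) -/
def StubN₂Normalisation : Prop :=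
  HolCotFormSpectralProjection₂Herm → holCotFormSpectralProjection₂

/-- **(K₂) THE CHART-FREE REPRODUCING KERNEL ON `U(σ_{w₁}H)(ℂ)` — the load-bearing analytic stub** (F0P5-p01 (g2) 01:36:27Z (i)).  For
`σ_{w₁}H` hermitian, a cone frame `𝔣`, a `𝔭`-probe family `γ` (`γ z = exp (X z)`, ★ `UnitaryCurveCone.exists_coneProbe` ∕ `exists_expFamily_archLocal`)
and every Haar measure `ν` on `U := U(σ_{w₁}H)(ℂ)`: there is a kernel `A : U → ℂ`, `IsRegularKernel₁ γ A` (continuous, compactly supported, `C¹`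
along left probes), which REPRODUCES every cone-holomorphic function at the identity: `∫ A(u) Φ(u) dν(u) = Φ(1)` for all `Φ` with ★ `IsConeHol 𝔣 Φ`.
WHY: on the cone-open `Φ(h) = (a k⁻¹)(h) · F(ζ(h))` with `ζ(h) = y∕x` the frame slope of `h v₀ = x v₀ + y t₀` and `F(ζ) := Φ(1 + ζ N)` (`N v₀ = t₀`,
`N t₀ = 0`) HOLOMORPHIC on the disc `|ζ|² < −⟪v₀,v₀⟫∕⟪t₀,t₀⟫` (cone law ★ `UnitaryCurveCone.exists_factorisation` ∕ `frame_coords_*` + clause 1 of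
`IsConeHol` along an affine line); take `A := α · (k a⁻¹) ∕ ∫ α dν` with `α ≥ 0` a smooth bump of the frame-coordinate moduli, left-`K_∞`-invariant;
`K_∞ ∋ k_θ` rotates `ζ ↦ e^{iθ} ζ`, so by left-invariance of `ν` and Fubini `∫ α F(ζ) dν = ∫ α · (circle average of F at radius |ζ|) dν = F(0) ∫ α dν`
(Mathlib one-variable mean value `circleAverage`), and `F(0) = Φ(1)`.  Reproduction at other points follows for free: `u ↦ Φ(y₀ u)` is again
`IsConeHol` for `y₀ ∈ U`.  Size M (≈ 400–550 l.), Mathlib + ★ A-p14 §1–§4 only; NO disc model of `U(1,1)`, no orbit push-forward formula.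
(print: Borel1997, §2.13–2.14 and §5.14) (print: HarishChandra1966, §8, Thm. 1) -/
def StubK₂ReproducingKernel : Prop :=
  ∀ (L : Type) [Field L] [NumberField L] [IsCMField L] (ι : L →+* ℂ) (H : Matrix (Fin 2) (Fin 2) L),
    (H.map (cmPlace L ι).1.embedding).IsHermitian →
    ∀ (𝔣 : ConeFrame L H (cmPlace L ι)) (X : ℂ →ₗ[ℝ] Matrix (Fin 2) (Fin 2) ℂ),
      (∀ z, (X z)ᴴ * H.map (cmPlace L ι).1.embedding + H.map (cmPlace L ι).1.embedding * X z = 0) →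
      (∀ z, X z *ᵥ 𝔣.v₀ = z • 𝔣.t₀) → (∀ z, ∃ c : ℂ, X z *ᵥ 𝔣.t₀ = c • 𝔣.v₀) →
    ∀ (γ : ℂ → archLocal L 2 H (cmPlace L ι)),
      (∀ z, ((γ z : GL (Fin 2) ℂ) : Matrix (Fin 2) (Fin 2) ℂ) = NormedSpace.exp (X z)) →
    ∀ [MeasurableSpace (archLocal L 2 H (cmPlace L ι))] [BorelSpace (archLocal L 2 H (cmPlace L ι))]
      (ν : Measure (archLocal L 2 H (cmPlace L ι))) [ν.IsHaarMeasure],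
      ∃ A : archLocal L 2 H (cmPlace L ι) → ℂ, IsRegularKernel₁ γ A ∧
        ∀ Φ : Matrix (Fin 2) (Fin 2) ℂ → ℂ, IsConeHol 𝔣 Φ →
          ∫ u, A u * Φ ((u : GL (Fin 2) ℂ) : Matrix (Fin 2) (Fin 2) ℂ) ∂ν = Φ 1

/-- **(S₂) The `L²` class of a cone-holomorphic cotangent form carries the `L²`-level cotangent data.**  In the engine setting (`σ_{w₁}H` hermitian; `H` definite at the places `≠ ι` and `[L:ℚ] ≥ 4`, so `U(H)` is anisotropic and the automorphic quotient compact), given a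
regular kernel `A` reproducing cone-holomorphic functions at `1`: for `f ∈ holCotForms₂ 𝔣` with square-integrable `toQuotFun f`, the class `[f]`
satisfies `IsL2CotPair₁ ν A`.  WHY: `repro` is the `L²` image of the pointwise identity `∫ A(u) f(y · sec u) dν = f(y)` (the slice of `f` at `y` is the
restriction of an `IsConeHol` function — clause (H) of ★ `mem_holCotForms₂_iff` — reproduced by (K₂)) under the FUBINI representative of
`∫ A(u) • R(sec u)[f] dν` (★ `coeFn_integral_rightRegular_toLp` pattern of ★ `F0P2dStubSOrbitMap`, parameter space `(U, ν|supp A)`); `kc` ∕ `kf` ∕ `ktype`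
are the `L²` images of the pointwise clauses of `mem_holCotForms₂_iff` and of the cone law under `R a [f] = [f(· a)]`; `diffOrbit` ∕ `weakHol`: the orbit
map `z ↦ R(sec (γ z))[f]` is the class of `y ↦ f(y · sec(γ z))`, whose probes are `C^∞` (★ `UnitaryCurveCone.contDiff_probe_of_isConeHol`) with CR at `0`
(★ `probeCR_of_isConeHol`), bounded on the compact quotient, so dominated convergence gives the `L²` derivative and its `ℂ`-linearity.  Size M.
(print: Borel1997, §2.13 and §5.14) (print: BorelJacquet1979, §4.2) -/
def StubS₂CotFormL2Data : Prop :=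
  ∀ (L : Type) [Field L] [NumberField L] [IsCMField L] (ι : L →+* ℂ) (H : Matrix (Fin 2) (Fin 2) L)
    (dV : Fin 2 → L) (_hdV : ∀ i, IsCMField.complexConj L (dV i) = dV i) (_hdV0 : ∀ i, dV i ≠ 0)
    (t : L) (_ht : t ≠ 0) (g : GL (Fin 2) L),
    formCongr ((IsCMField.complexConj L : L ≃ₐ[↥(maximalRealSubfield L)] L) : L →+* L) g (t • H) = Matrix.diagonal dV →
    (H.map (cmPlace L ι).1.embedding).IsHermitian →
    (∃ T : GL (Fin 2) ℂ, formCongr (starRingEnd ℂ) T ((Matrix.diagonal dV).map ι) = Matrix.diagonal ![(1 : ℂ), -1]) →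
    (∀ τ' : L →+* ℂ, InfinitePlace.mk τ' ≠ InfinitePlace.mk ι → ((Matrix.diagonal dV).map τ').PosDef) →
    4 ≤ Module.finrank ℚ L →
    ∀ (𝔣 : ConeFrame L H (cmPlace L ι)) (X : ℂ →ₗ[ℝ] Matrix (Fin 2) (Fin 2) ℂ),
      (∀ z, (X z)ᴴ * H.map (cmPlace L ι).1.embedding + H.map (cmPlace L ι).1.embedding * X z = 0) →
      (∀ z, X z *ᵥ 𝔣.v₀ = z • 𝔣.t₀) → (∀ z, ∃ c : ℂ, X z *ᵥ 𝔣.t₀ = c • 𝔣.v₀) →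
    ∀ (γ : ℂ → archLocal L 2 H (cmPlace L ι)),
      (∀ z, ((γ z : GL (Fin 2) ℂ) : Matrix (Fin 2) (Fin 2) ℂ) = NormedSpace.exp (X z)) →
    ∀ (μ : Measure (G2 L H).automorphicQuotient) [(G2 L H).IsAutomorphicMeasure μ]
      [MeasurableSpace (archLocal L 2 H (cmPlace L ι))] [BorelSpace (archLocal L 2 H (cmPlace L ι))]
      (ν : Measure (archLocal L 2 H (cmPlace L ι))) [ν.IsHaarMeasure] (A : archLocal L 2 H (cmPlace L ι) → ℂ),
      IsRegularKernel₁ γ A →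
      (∀ Φ : Matrix (Fin 2) (Fin 2) ℂ → ℂ, IsConeHol 𝔣 Φ → ∫ u, A u * Φ ((u : GL (Fin 2) ℂ) : Matrix (Fin 2) (Fin 2) ℂ) ∂ν = Φ 1) →
    ∀ (f : (G2 L H).Adelic → ℂ),
      f ∈ holCotForms₂ (↥(maximalRealSubfield L)) L (IsCMField.complexConj L) H (IsCMField.complexConj_ne_one L)
          (UnitaryGroup.complexConj_smul_infinitePlace L) (cmPlace L ι) 𝔣 →
    ∀ hf : MemLp (toQuotFun (G2 L H) f) 2 μ,
      IsL2CotPair₁ L ι H 𝔣 γ μ ν A (MemLp.toLp (toQuotFun (G2 L H) f) hf)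

/-- **(H₂) `pr_P` transports the `L²`-level cotangent data** (re-instantiation of ★ A-p06 `F0P2dStubHProjectedL2Data` §1–§2, whose lemmas are
`AdelicGroupData`-generic: `pr_P` is continuous linear and commutes with `R(g)`, so it passes through the Bochner integral of `kernelOp₁`, through the
invariances and the type relation, and through the `𝔭`-orbit map and its differential).  Size S–M. (print: BorelJacquet1979, §4.6)
(print: DeitmarEchterhoff2014, Thm. 7.3.2) -/
def StubH₂ProjectedL2Data : Prop :=
  ∀ (L : Type) [Field L] [NumberField L] [IsCMField L] (ι : L →+* ℂ) (H : Matrix (Fin 2) (Fin 2) L)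
    (𝔣 : ConeFrame L H (cmPlace L ι)) (γ : ℂ → archLocal L 2 H (cmPlace L ι))
    (μ : Measure (G2 L H).automorphicQuotient) [(G2 L H).IsAutomorphicMeasure μ]
    [MeasurableSpace (archLocal L 2 H (cmPlace L ι))] [BorelSpace (archLocal L 2 H (cmPlace L ι))]
    (ν : Measure (archLocal L 2 H (cmPlace L ι))) [ν.IsHaarMeasure] (A : archLocal L 2 H (cmPlace L ι) → ℂ)
    (P : DiscreteAutomorphicRep (G2 L H) μ) (u : (G2 L H).L2 μ),
      IsL2CotPair₁ L ι H 𝔣 γ μ ν A u → IsL2CotPair₁ L ι H 𝔣 γ μ ν A (P.space.toSubmodule.starProjection u)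

/-- **(R₂) REGULARITY OF REPRODUCED CLASSES** — a right-`K_c K_f`-invariant `L²` class on the compact quotient reproduced by a regular kernel,
`w = T_A w`, has a CONTINUOUS representative, `C¹` along the `𝔭`-probes, with probe derivatives continuous in the base point and representing the
`L²`-derivatives (`Realises₁`).  Port of ★ `F0P2dStubREngine` + `F0P2dStubR` (p04 (g2)) with `U21 ↦ U(σ_{w₁}H)`, `cmArchSection ↦ adelicSingle w₁`,
`cmCompactFactor ↦ K_c`: choose an everywhere `K_c K_f`-invariant version of the class (Haar averaging over the compact `K_c` — ★
`isCompact_archLocal` at the definite places — and the compact open `K_f`), put `Ψ(y) := ∫ A(u) w̄(y · sec u) dν(u)`, defined EVERYWHERE because the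
bad set is a null union of translates of the OPEN `sec(U) · K_c · K_f`-cosets (`μ` charges opens); continuity∕`C¹` along `U`-orbits by left-invariance
of `ν` and differentiation under the integral (`IsRegularKernel₁`), across orbits by `K_c K_f`-invariance and the product structure.  Size M.
(print: Borel1997, Thm. 2.13 and §8.4) (print: HarishChandra1966, §8) (print: BorelJacquet1979, §4.1–4.2) -/
def StubR₂RegularOfReproduced : Prop :=
  ∀ (L : Type) [Field L] [NumberField L] [IsCMField L] (ι : L →+* ℂ) (H : Matrix (Fin 2) (Fin 2) L)
    (dV : Fin 2 → L) (_hdV : ∀ i, IsCMField.complexConj L (dV i) = dV i) (_hdV0 : ∀ i, dV i ≠ 0)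
    (t : L) (_ht : t ≠ 0) (g : GL (Fin 2) L),
    formCongr ((IsCMField.complexConj L : L ≃ₐ[↥(maximalRealSubfield L)] L) : L →+* L) g (t • H) = Matrix.diagonal dV →
    (H.map (cmPlace L ι).1.embedding).IsHermitian →
    (∃ T : GL (Fin 2) ℂ, formCongr (starRingEnd ℂ) T ((Matrix.diagonal dV).map ι) = Matrix.diagonal ![(1 : ℂ), -1]) →
    (∀ τ' : L →+* ℂ, InfinitePlace.mk τ' ≠ InfinitePlace.mk ι → ((Matrix.diagonal dV).map τ').PosDef) →
    4 ≤ Module.finrank ℚ L →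
    ∀ (𝔣 : ConeFrame L H (cmPlace L ι)) (X : ℂ →ₗ[ℝ] Matrix (Fin 2) (Fin 2) ℂ),
      (∀ z, (X z)ᴴ * H.map (cmPlace L ι).1.embedding + H.map (cmPlace L ι).1.embedding * X z = 0) →
    ∀ (γ : ℂ → archLocal L 2 H (cmPlace L ι)),
      (∀ z, ((γ z : GL (Fin 2) ℂ) : Matrix (Fin 2) (Fin 2) ℂ) = NormedSpace.exp (X z)) →
    ∀ (μ : Measure (G2 L H).automorphicQuotient) [(G2 L H).IsAutomorphicMeasure μ]
      [MeasurableSpace (archLocal L 2 H (cmPlace L ι))] [BorelSpace (archLocal L 2 H (cmPlace L ι))]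
      (ν : Measure (archLocal L 2 H (cmPlace L ι))) [ν.IsHaarMeasure] (A : archLocal L 2 H (cmPlace L ι) → ℂ),
      IsRegularKernel₁ γ A →
    ∀ (w : (G2 L H).L2 μ),
      kernelOp₁ (G2 L H) μ (sec₁ L ι H) ν A w = w →
      (∀ k ∈ Kc₁ L ι H, (G2 L H).rightRegular μ k w = w) →
      (∃ Kf : Subgroup (finAdelic (↥(maximalRealSubfield L)) L (IsCMField.complexConj L) 2 H),
        IsOpen (Kf : Set (finAdelic (↥(maximalRealSubfield L)) L (IsCMField.complexConj L) 2 H)) ∧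
          ∀ k ∈ Kf, (G2 L H).rightRegular μ (finAdelicToAdelic (↥(maximalRealSubfield L)) L (IsCMField.complexConj L) 2 H k) w = w) →
        ∃ Ψ : (G2 L H).Adelic → ℂ, Realises₁ (G2 L H) μ (sec₁ L ι H) γ Ψ w

/-- **(G₂) Pointwise Cauchy–Riemann along the probe from the weak one.**  If `Ψ` `Realises₁` `w` and `w` is weakly holomorphic, then at EVERY base
point `y` the probe `z ↦ Ψ(y · sec (γ z))` (differentiable at `0` by `Realises₁.diff`) has `ℂ`-LINEAR differential: the Cauchy–Riemann defect
`y ↦ ∂Ψ(y)(I z) − I ∂Ψ(y)(z)` is continuous (`contDeriv`), left-invariant, and its class is `D(I z) − I D(z) = 0` (`derivAe`, `IsWeaklyHol₁`), so it vanishes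
a.e., hence everywhere (`μ` charges opens; ★ `P2StubGHolGermOfWeak.eq_zero_of_toQuotFun_ae_eq_zero` is `AdelicGroupData`-generic and reusable
verbatim).  Port of ★ p797242 with one coordinate.  Size M−. (print: Borel1997, §5.14) (print: BorelWallach2000, VII 2.10) -/
def StubG₂ProbeCROfWeak : Prop :=
  ∀ (L : Type) [Field L] [NumberField L] [IsCMField L] (ι : L →+* ℂ) (H : Matrix (Fin 2) (Fin 2) L)
    (γ : ℂ → archLocal L 2 H (cmPlace L ι))
    (μ : Measure (G2 L H).automorphicQuotient) [(G2 L H).IsAutomorphicMeasure μ]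
    (w : (G2 L H).L2 μ) (Ψ : (G2 L H).Adelic → ℂ),
      Realises₁ (G2 L H) μ (sec₁ L ι H) γ Ψ w → IsWeaklyHol₁ (G2 L H) μ (sec₁ L ι H) γ w →
        ∀ (y : (G2 L H).Adelic) (z : ℂ),
          fderiv ℝ (probeP₁ (G2 L H) (sec₁ L ι H) γ Ψ y) 0 (Complex.I • z) =
            Complex.I • fderiv ℝ (probeP₁ (G2 L H) (sec₁ L ι H) γ Ψ y) 0 z

/-- **(T₂) Pointwise invariances from the a.e. ones, then the CONE DICTIONARY: the regular representative is a cone-holomorphic cotangent form.**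
If `Ψ` `Realises₁` `w`, the class `w` carries the `L²`-level `K_c` ∕ `K_f` ∕ cotangent-type relations, and the probes of `Ψ` have `ℂ`-linear differentials
at every base point, then `Ψ ∈ holCotForms₂ 𝔣`: left `U(H)(L⁺)`-invariance from `Realises₁.leftInv` (★ `arithmeticSubgroup_le_quotientSubgroup`); the
right identities `Ψ(x k) = Ψ(x)` (`k ∈ K_c`, `k ∈ K_f`) and `Ψ(x · sec κ) = (a k⁻¹) Ψ(x)` are identities between CONTINUOUS left-invariant functions holding
a.e. by the `L²` relations and `R a [Ψ] = [Ψ(· a)]`, hence everywhere (`μ` charges opens — the generic §1 of ★ `F0P2dStubT`, p797536); then ★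
`UnitaryCurveCone.mem_holCotForms₂_of_probeCR` (A-p14 (g16), p800952: `K_∞`-type + probe differentiability + CR at every adelic point ⇒ membership,
by the cone extension and the inverse-function-theorem chart — NO disc model).  Size M− (≈ 150 l. new).  Needs `σ_{w₁}H` hermitian.
(print: BorelJacquet1979, §4.2) (print: Borel1997, §5.14) -/
def StubT₂MemHolCotFormsOfAe : Prop :=
  ∀ (L : Type) [Field L] [NumberField L] [IsCMField L] (ι : L →+* ℂ) (H : Matrix (Fin 2) (Fin 2) L),
    (H.map (cmPlace L ι).1.embedding).IsHermitian →
    ∀ (𝔣 : ConeFrame L H (cmPlace L ι)) (X : ℂ →ₗ[ℝ] Matrix (Fin 2) (Fin 2) ℂ),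
      (∀ z, (X z)ᴴ * H.map (cmPlace L ι).1.embedding + H.map (cmPlace L ι).1.embedding * X z = 0) →
      (∀ z, X z *ᵥ 𝔣.v₀ = z • 𝔣.t₀) → (∀ z, ∃ c : ℂ, X z *ᵥ 𝔣.t₀ = c • 𝔣.v₀) →
    ∀ (γ : ℂ → archLocal L 2 H (cmPlace L ι)),
      (∀ z, ((γ z : GL (Fin 2) ℂ) : Matrix (Fin 2) (Fin 2) ℂ) = NormedSpace.exp (X z)) →
    ∀ (μ : Measure (G2 L H).automorphicQuotient) [(G2 L H).IsAutomorphicMeasure μ]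
      (w : (G2 L H).L2 μ) (Ψ : (G2 L H).Adelic → ℂ),
      Realises₁ (G2 L H) μ (sec₁ L ι H) γ Ψ w →
      (∀ k ∈ Kc₁ L ι H, (G2 L H).rightRegular μ k w = w) →
      (∃ Kf : Subgroup (finAdelic (↥(maximalRealSubfield L)) L (IsCMField.complexConj L) 2 H),
        IsOpen (Kf : Set (finAdelic (↥(maximalRealSubfield L)) L (IsCMField.complexConj L) 2 H)) ∧
          ∀ k ∈ Kf, (G2 L H).rightRegular μ (finAdelicToAdelic (↥(maximalRealSubfield L)) L (IsCMField.complexConj L) 2 H k) w = w) →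
      (∀ (κ : archLocal L 2 H (cmPlace L ι)) (a k d : ℂ), k ≠ 0 →
        ((κ : GL (Fin 2) ℂ) : Matrix (Fin 2) (Fin 2) ℂ) *ᵥ 𝔣.v₀ = k • 𝔣.v₀ →
        ((κ : GL (Fin 2) ℂ) : Matrix (Fin 2) (Fin 2) ℂ) *ᵥ 𝔣.t₀ = a • 𝔣.t₀ + d • 𝔣.v₀ →
          (G2 L H).rightRegular μ (sec₁ L ι H κ) w = (a * k⁻¹) • w) →
      (∀ (y : (G2 L H).Adelic) (z : ℂ),
        fderiv ℝ (probeP₁ (G2 L H) (sec₁ L ι H) γ Ψ y) 0 (Complex.I • z) =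
          Complex.I • fderiv ℝ (probeP₁ (G2 L H) (sec₁ L ι H) γ Ψ y) 0 z) →
        Ψ ∈ holCotForms₂ (↥(maximalRealSubfield L)) L (IsCMField.complexConj L) H (IsCMField.complexConj_ne_one L)
          (UnitaryGroup.complexConj_smul_infinitePlace L) (cmPlace L ι) 𝔣

/-- (N₂) registered stub — CLOSED by the R1 (α-lite) letter edition (★ `UnitaryCurveCotangentSpectralProjection` ed. 3 carries the hermitian
binder at the same position as `HolCotFormSpectralProjection₂Herm`, so the two letters are definitionally equal). [cite: BorelJacquet1979, §4.6] -/
theorem stub_N₂ : StubN₂Normalisation :=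
  fun h => h

/-- (K₂) registered stub — ★ CLOSED by `Literature/NumberTheory/Automorphic/UnitaryCurveConeReproducingKernel.lean` (F0P5-p01 (g2), p803171).
[cite: Borel1997, §2.13–2.14] [cite: HarishChandra1966, §8, Thm. 1] -/
theorem stub_K₂ : StubK₂ReproducingKernel :=
  fun _ _ _ _ _ _ hJ 𝔣 X _ _ _ γ hγ _ _ ν _ =>
    (UnitaryCurveForms.exists_coneReproducingKernel_probe 𝔣 (UnitaryCurveCone.form_v₀_t₀ 𝔣 hJ) X γ hγ ν).imp fun _ h =>
      ⟨⟨h.1.1, h.1.2.1, h.1.2.2.1, h.1.2.2.2⟩, fun Φ hΦ => (h.2 Φ hΦ).2⟩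

/-- (S₂) registered stub — ★ CLOSED by `Theorems/F0P5TP2StubS.lean` (F0P2-p02 (g2); GREEN first, 02:19Z — desk rule «green bytes win»);
an independent second ★ proof by the first-order road is `Theorems/F0P5TP2StubS2.lean` (A-p14 (g16), p803774). [cite: Borel1997, §5.14] -/
theorem stub_S₂ : StubS₂CotFormL2Data :=
  fun L _ _ _ ι H dV hdV hdV0 t ht g hg hJ hsig hdef h4 𝔣 X hXu hXv hXt γ hγ μ _ _ _ ν _ A hA hrep f hf hmem =>
    let h := Summit.HodgeConjecture.HodgeConjecture.Cruxes.HLiu418.F0P5TP2StubS.stubS₂_holds L ι H dV hdV hdV0 t ht g hg hJ hsig hdef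
      h4 𝔣 X hXu hXv hXt γ hγ μ ν A hA.cont hA.supp hA.diff hA.contDeriv hrep f hf hmem
    ⟨h.1, h.2.1, h.2.2.1, h.2.2.2.1, h.2.2.2.2.1, h.2.2.2.2.2⟩

/-- (H₂) registered stub — ★ CLOSED by `Theorems/F0P5TP2StubH2ProjectedL2Data.lean` (A-p02 (g18), p802104). [cite: BorelJacquet1979, §4.6] -/
theorem stub_H₂ : StubH₂ProjectedL2Data :=
  fun L _ _ _ ι H 𝔣 γ μ _ _ _ ν _ A P u hu =>
    let h := Summit.HodgeConjecture.HodgeConjecture.Cruxes.HLiu418.F0P5TP2StubH2ProjectedL2Data.stubH₂_holds L ι H 𝔣 γ μ ν A P u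
      hu.repro hu.kc hu.kf hu.ktype hu.diffOrbit hu.weakHol
    ⟨h.1, h.2.1, h.2.2.1, h.2.2.2.1, h.2.2.2.2.1, h.2.2.2.2.2⟩

/-- (R₂) registered stub — ★ CLOSED by `Theorems/F0P5TP2StubR2.lean` (+ `…R2Engine`, `…R2Psi`; A-p04 (g21), p803290 ∕ p803595 ∕ p803709).
[cite: Borel1997, Thm. 2.13 and §8.4] -/
theorem stub_R₂ : StubR₂RegularOfReproduced := by
  intro L _ _ _ ι H dV hdV hdV0 t ht g hdiag hJ hT hdef h4 𝔣 X hXu γ hγ μ _ _ _ ν _ A hA w hrep hkc hkf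
  obtain ⟨Ψ, h⟩ := Summit.HodgeConjecture.HodgeConjecture.Cruxes.HLiu418.F0P5TP2StubR2.stubR₂_holds L ι H dV hdV hdV0 t ht g hdiag hJ hT
    hdef h4 𝔣 X hXu γ hγ μ ν A hA.cont hA.supp hA.diff hA.contDeriv w hrep hkc hkf
  exact ⟨Ψ, h.1, h.2.1, h.2.2.1, h.2.2.2.1, h.2.2.2.2.1, h.2.2.2.2.2⟩

/-- (G₂) registered stub — ★ CLOSED by `Theorems/F0P5TP2StubG.lean` (A-p04 (g21)). [cite: Borel1997, §5.14] -/
theorem stub_G₂ : StubG₂ProbeCROfWeak :=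
  fun L _ _ _ ι H γ μ _ w Ψ hR hW =>
    Summit.HodgeConjecture.HodgeConjecture.Cruxes.HLiu418.F0P5TP2StubG.stubG₂_holds (G2 L H) μ (sec₁ L ι H) γ w Ψ
      hR.leftInv hR.cont hR.aeEq hR.diff hR.contDeriv hR.derivAe hW

/-- (T₂) registered stub — ★ CLOSED by `Theorems/F0P5TP2StubT.lean` (A-p14 (g16), p802076). [cite: BorelJacquet1979, §4.2] -/
theorem stub_T₂ : StubT₂MemHolCotFormsOfAe :=
  fun L _ _ _ ι H hJ 𝔣 X hXu hXv hXt γ hγ μ _ w Ψ hΨ =>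
    Summit.HodgeConjecture.HodgeConjecture.Cruxes.HLiu418.F0P5TP2StubT.stubT₂_holds L ι H hJ 𝔣 X hXu hXv hXt γ hγ μ w Ψ
      ⟨hΨ.leftInv, hΨ.cont, hΨ.aeEq, hΨ.diff, hΨ.contDeriv, hΨ.derivAe⟩

section Heads

open scoped Matrix.Norms.Operator

/-! ## §3 Heads (sorry-free): TP₂ at hermitian `σ_{w₁}H` from the five analytic stubs; the named fact BY NAME via (N₂); (D̄₂) by ★ `…_of_hol` -/

/-- **HEAD — TP₂ AT HERMITIAN `σ_{w₁}H` from (K₂)(S₂)(H₂)(R₂)(G₂)(T₂).**  Plumbing only: the frame's `𝔭`-probe `X` and its family `γ` (★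
`UnitaryCurveCone.exists_coneProbe`, `exists_expFamily_archLocal`), a Haar measure `ν` on `U(σ_{w₁}H)(ℂ)` (Borel structure `borel`), the kernel `A` of (K₂);
`u := [f]` (S₂) ↦ `w := pr_P u` (H₂) ↦ a regular representative `Ψ` of the reproduced class `w = T_A w` (R₂) ↦ pointwise CR (G₂) ↦ `Ψ ∈ holCotForms₂ 𝔣` (T₂);
the classes agree by `Realises₁.aeEq`. [cite: BorelJacquet1979, §4.6] [cite: Borel1997, Thm. 2.13] -/
theorem holCotFormSpectralProjection₂Herm_of (sK : StubK₂ReproducingKernel) (sS : StubS₂CotFormL2Data) (sH : StubH₂ProjectedL2Data)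
    (sR : StubR₂RegularOfReproduced) (sG : StubG₂ProbeCROfWeak) (sT : StubT₂MemHolCotFormsOfAe) : HolCotFormSpectralProjection₂Herm := by
  intro L _ _ _ ι H dV hdV hdV0 t ht g hdiag hJ hsig hdef h4 𝔣 μ _ P f hfmem hf
  -- the probe and its one-parameter family
  obtain ⟨X, hXu, hXv, hXt⟩ := UnitaryCurveCone.exists_coneProbe 𝔣 hJ
  obtain ⟨γ, hγ⟩ := UnitaryCurveCone.exists_expFamily_archLocal 𝔣 hJ X hXu
  -- a Borel structure and a Haar measure on `U(σ_{w₁}H)(ℂ)`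
  letI : MeasurableSpace (archLocal L 2 H (cmPlace L ι)) := borel _
  haveI : BorelSpace (archLocal L 2 H (cmPlace L ι)) := ⟨rfl⟩
  haveI : LocallyCompactSpace (Matrix (Fin 2) (Fin 2) ℂ) := inferInstanceAs (LocallyCompactSpace (Fin 2 → Fin 2 → ℂ))
  haveI : LocallyCompactSpace (GL (Fin 2) ℂ) := (Units.isOpenEmbedding_val (R := Matrix (Fin 2) (Fin 2) ℂ)).locallyCompactSpace
  haveI : LocallyCompactSpace (archLocal L 2 H (cmPlace L ι)) :=
    (isClosed_archLocal L 2 H (cmPlace L ι)).isClosedEmbedding_subtypeVal.locallyCompactSpace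
  set ν : Measure (archLocal L 2 H (cmPlace L ι)) := Measure.haar with hν
  -- (K₂)
  obtain ⟨A, hA, hrep⟩ := sK L ι H hJ 𝔣 X hXu hXv hXt γ hγ ν
  -- (S₂), (H₂)
  have hu : IsL2CotPair₁ L ι H 𝔣 γ μ ν A (MemLp.toLp (toQuotFun (G2 L H) f) hf) :=
    sS L ι H dV hdV hdV0 t ht g hdiag hJ hsig hdef h4 𝔣 X hXu hXv hXt γ hγ μ ν A hA hrep f hfmem hf
  have hw := sH L ι H 𝔣 γ μ ν A P _ hu
  -- (R₂)
  obtain ⟨Ψ, hΨ⟩ := sR L ι H dV hdV hdV0 t ht g hdiag hJ hsig hdef h4 𝔣 X hXu γ hγ μ ν A hA _ hw.repro hw.kc hw.kf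
  -- (G₂), (T₂)
  have hCR := sG L ι H γ μ _ Ψ hΨ hw.weakHol
  have hmem := sT L ι H hJ 𝔣 X hXu hXv hXt γ hγ μ _ Ψ hΨ hw.kc hw.kf hw.ktype hCR
  have hmemLp : MemLp (toQuotFun (G2 L H) Ψ) 2 μ := (Lp.memLp _).ae_eq hΨ.aeEq.symm
  refine ⟨Ψ, hmem, hmemLp, ?_⟩
  refine (Lp.ext ?_).symm
  exact (MemLp.coeFn_toLp hmemLp).trans hΨ.aeEq

/-- **HEAD — the named fact ★ `UnitaryCurveForms.holCotFormSpectralProjection₂` BY NAME from the seven stubs** (the registrar's one-token fold of the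
parent's `stub_TPhol`). [cite: BorelJacquet1979, §4.6] -/
theorem holCotFormSpectralProjection₂_of_stubs (sN : StubN₂Normalisation) (sK : StubK₂ReproducingKernel) (sS : StubS₂CotFormL2Data)
    (sH : StubH₂ProjectedL2Data) (sR : StubR₂RegularOfReproduced) (sG : StubG₂ProbeCROfWeak) (sT : StubT₂MemHolCotFormsOfAe) :
    holCotFormSpectralProjection₂ :=
  sN (holCotFormSpectralProjection₂Herm_of sK sS sH sR sG sT)

/-- **(D̄₂) from the same stubs** via ★ `UnitaryCurveForms.antiholCotFormSpectralProjection₂_of_hol` (A-p06 (g18), p797687). [cite: BorelWallach2000, VII 2.10] -/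
theorem antiholCotFormSpectralProjection₂_of_stubs (sN : StubN₂Normalisation) (sK : StubK₂ReproducingKernel) (sS : StubS₂CotFormL2Data)
    (sH : StubH₂ProjectedL2Data) (sR : StubR₂RegularOfReproduced) (sG : StubG₂ProbeCROfWeak) (sT : StubT₂MemHolCotFormsOfAe) :
    antiholCotFormSpectralProjection₂ :=
  antiholCotFormSpectralProjection₂_of_hol (holCotFormSpectralProjection₂_of_stubs sN sK sS sH sR sG sT)

/-- **What the parent line's named-fact stub becomes**: both P5 letters TP₂-hol ∕ TP₂-antihol from the seven stubs. [cite: BorelJacquet1979, §4.6] -/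
theorem socketTP₂_of_stubs : StubN₂Normalisation → StubK₂ReproducingKernel → StubS₂CotFormL2Data → StubH₂ProjectedL2Data →
    StubR₂RegularOfReproduced → StubG₂ProbeCROfWeak → StubT₂MemHolCotFormsOfAe →
      holCotFormSpectralProjection₂ ∧ antiholCotFormSpectralProjection₂ :=
  fun sN sK sS sH sR sG sT =>
    ⟨holCotFormSpectralProjection₂_of_stubs sN sK sS sH sR sG sT, antiholCotFormSpectralProjection₂_of_stubs sN sK sS sH sR sG sT⟩

/-- **The parent's stub, by name** (what `Lines/F0_AlbCm.lean` ED. 5 writes as the body of `stub_TPhol`). [cite: BorelJacquet1979, §4.6] -/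
theorem stub_TPhol_holds : holCotFormSpectralProjection₂ :=
  holCotFormSpectralProjection₂_of_stubs stub_N₂ stub_K₂ stub_S₂ stub_H₂ stub_R₂ stub_G₂ stub_T₂

end Heads

end Summit.HodgeConjecture.HodgeConjecture.Cruxes.HLiu418.F0P5TP2SpectralProjection

end
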